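import Summits.AnomalousDissipation.AnomalousDissipation.Theorems.SawtoothPulseCascadeK1LocalisedCascadeRatioClassStepV

/-!
# K1loc, line `Spectral` / thin start — helper: PER-FIBRE PLATEAU AND KERNEL CONSTANTS OF A FIBRE BLOCK

Helper file of the prover lane on the crux `K1LocalisedCascade` (stmt-AnomalousDissipation-19491), route `SawtoothPulseCascade`
(S-B/S-C assembly seat; the LEDGER ASSEMBLY, block layer).  The window theorems `…ClassStepV/H.sum_window_iterate_{v,h}step_le`
ask, fibre by fibre on a block `Λ ≤ |n|`, for: the plateau `p(n)` below the chirp shift (`p(n) < |n|G`), the window under the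
plateau (`|k_w| + Q₂ ≤ p(n)`), the trapezoid ratio `(p(n) + |n|G)/(|n|G − p(n)) ≤ A` and the layer `π/(|n|G − p(n)) ≤ τ`.
`…RatioClassStepV` / `…StripStepV` discharge these inside their proofs; this file states them once as lemmas, so that the multi-block
class steps (`…ClassBlocks`) reduce to per-block SCALAR conditions:
* §1 ratio window `|k_w| ≤ (v/u)|n|`, plateau `⌊v|n|/u⌋ + Q₂`: `ratioPlateau_lt_shift`, `ratioPlateau_window`,
  `ratioKernel_ratio_le` (`A = ((v+uG)Λ + uQ₂)/((uG−v)Λ − uQ₂)`), `ratioKernel_tau_le` (`τ = uπ/((uG−v)Λ − uQ₂)`), under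
  `uQ₂ < Λ(uG − v)`;
* §2 strip / low-fibre window `|k_w| < K`, plateau `K + Q₂`: `stripPlateau_lt_shift`, `stripKernel_ratio_le`
  (`A = (K+Q₂+ΛG)/(ΛG−K−Q₂)`), `stripKernel_tau_le` (`τ = π/(ΛG−K−Q₂)`), under `K + Q₂ < ΛG`.
Pure arithmetic; no definitions; no statement about the crux. [cite: Grafakos2014, §3.1.3] [problem: turb]
-/

-- `Summit.<Summit>.<Problem>`: single-conjunct summit, the duplicate namespace segment is deliberate.
set_option linter.dupNamespace false

noncomputable section

namespace Summit.AnomalousDissipation.AnomalousDissipation.Theorems.SawtoothPulseCascade.K1Window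

/-! ## §1 The ratio window (plateau `⌊v|n|/u⌋ + Q₂`) -/

/-- **The ratio plateau stays below the chirp shift** (R1): for the window `|k₀| ≤ (v/u)|n|` on the fibre `n` with cut-off
`Q₂` and `uQ₂ < Λ(uG − v)`, every fibre `|n| ≥ Λ` has `⌊v|n|/u⌋ + Q₂ < |n|G`. [folklore] -/
theorem ratioPlateau_lt_shift {u v G Q₂ Λ : ℕ} (hvu : v < u * G) (hΛQ : u * Q₂ < Λ * (u * G - v))
    {n : ℤ} (hn : (Λ : ℤ) ≤ |n|) : v * n.natAbs / u + Q₂ < n.natAbs * G := by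
  have h1 : Λ ≤ n.natAbs := by
    rw [← Int.natCast_natAbs] at hn; exact_mod_cast hn
  have key : u * (v * n.natAbs / u + Q₂) < u * (n.natAbs * G) := by
    have hdiv : u * (v * n.natAbs / u) ≤ v * n.natAbs := Nat.mul_div_le _ _
    have hΛQ' : u * Q₂ < n.natAbs * (u * G - v) := lt_of_lt_of_le hΛQ (Nat.mul_le_mul_right _ h1)
    have e : n.natAbs * (u * G - v) + v * n.natAbs = u * (n.natAbs * G) := by zify [hvu.le]; ring
    rw [Nat.mul_add]; omega
  exact Nat.lt_of_mul_lt_mul_left key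

/-- **The ratio window lies under its plateau** (R2): `u|k₀| ≤ v|n|` gives `|k₀| + Q₂ ≤ ⌊v|n|/u⌋ + Q₂`. [folklore] -/
theorem ratioPlateau_window {u v : ℕ} (Q₂ : ℕ) (hu : 0 < u) {k₀ n : ℤ} (h : (u : ℤ) * |k₀| ≤ (v : ℤ) * |n|) :
    |k₀| + (Q₂ : ℤ) ≤ ((v * n.natAbs / u + Q₂ : ℕ) : ℤ) := by
  simp only [Nat.cast_add]
  have : |k₀| ≤ ((v * n.natAbs / u : ℕ) : ℤ) := by
    rw [Int.natCast_div, Nat.cast_mul, Int.natCast_natAbs]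
    exact Int.le_ediv_of_mul_le (by exact_mod_cast hu) (by linarith [mul_comm (u : ℤ) (|k₀|)])
  linarith

/-- **The trapezoid RATIO constant of a fibre block** (R3): with the plateau `p(n) = ⌊v|n|/u⌋ + Q₂`, every fibre `|n| ≥ Λ`
has `(p(n) + |n|G)/(|n|G − p(n)) ≤ ((v+uG)Λ + uQ₂)/((uG−v)Λ − uQ₂)` (the bound is decreasing in `|n|`; extracted from the proof
of `…RatioClassStepV.tsum_ratioClass_vstep_le`). [folklore] -/
theorem ratioKernel_ratio_le {u v G Q₂ Λ : ℕ} (hu : 0 < u) (hvu : v < u * G) (hΛQ : u * Q₂ < Λ * (u * G - v))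
    {n : ℤ} (hn : (Λ : ℤ) ≤ |n|) :
    (((v * n.natAbs / u + Q₂ : ℕ) : ℝ) + ((n.natAbs * G : ℕ) : ℝ)) /
        (((n.natAbs * G : ℕ) : ℝ) - ((v * n.natAbs / u + Q₂ : ℕ) : ℝ)) ≤
      (((v : ℝ) + u * G) * Λ + u * Q₂) / (((u : ℝ) * G - v) * Λ - u * Q₂) := by
  have hur : (0 : ℝ) < u := by exact_mod_cast hu
  have hc2 : (0 : ℝ) < (u : ℝ) * G - v := by
    have : (v : ℝ) < (u : ℝ) * G := by exact_mod_cast hvu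
    linarith
  have hΛr : (u : ℝ) * Q₂ < ((u : ℝ) * G - v) * Λ := by
    have h1 : ((u * Q₂ : ℕ) : ℝ) < ((Λ * (u * G - v) : ℕ) : ℝ) := by exact_mod_cast hΛQ
    rw [Nat.cast_mul, Nat.cast_mul, Nat.cast_sub hvu.le, Nat.cast_mul] at h1
    linarith
  have hx : (Λ : ℝ) ≤ (n.natAbs : ℝ) := by
    have h1 : Λ ≤ n.natAbs := by rw [← Int.natCast_natAbs] at hn; exact_mod_cast hn
    exact_mod_cast h1
  have hup : (u : ℝ) * ((v * n.natAbs / u + Q₂ : ℕ) : ℝ) ≤ (v : ℝ) * (n.natAbs : ℝ) + u * Q₂ := by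
    have h : u * (v * n.natAbs / u + Q₂) ≤ v * n.natAbs + u * Q₂ := by
      have hdiv : u * (v * n.natAbs / u) ≤ v * n.natAbs := Nat.mul_div_le _ _
      rw [Nat.mul_add]; exact Nat.add_le_add_right hdiv _
    exact_mod_cast h
  have hpG' : ((v * n.natAbs / u + Q₂ : ℕ) : ℝ) < ((n.natAbs * G : ℕ) : ℝ) := by
    exact_mod_cast ratioPlateau_lt_shift hvu hΛQ hn
  have hnG : ((n.natAbs * G : ℕ) : ℝ) = (n.natAbs : ℝ) * G := by push_cast; rfl
  rw [hnG] at hpG' ⊢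
  set p : ℝ := ((v * n.natAbs / u + Q₂ : ℕ) : ℝ) with hp
  have hD1 : 0 < ((u : ℝ) * G - v) * (n.natAbs : ℝ) - u * Q₂ := by nlinarith
  have step1 : (p + (n.natAbs : ℝ) * G) / ((n.natAbs : ℝ) * G - p) ≤
      (((v : ℝ) + u * G) * (n.natAbs : ℝ) + u * Q₂) / (((u : ℝ) * G - v) * (n.natAbs : ℝ) - u * Q₂) := by
    rw [div_le_div_iff₀ (by linarith) hD1]
    have key : 0 ≤ (n.natAbs : ℝ) * G * ((v : ℝ) * (n.natAbs : ℝ) + u * Q₂ - u * p) :=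
      mul_nonneg (by positivity) (by linarith)
    nlinarith [key]
  refine step1.trans ?_
  exact ratioClass_ratio_le hx hΛr (by positivity) (by positivity) hc2

/-- **The kernel LAYER constant of a fibre block** (R4): with `p(n) = ⌊v|n|/u⌋ + Q₂`, every fibre `|n| ≥ Λ` has
`π/(|n|G − p(n)) ≤ uπ/((uG−v)Λ − uQ₂)`. [folklore] -/
theorem ratioKernel_tau_le {u v G Q₂ Λ : ℕ} (hu : 0 < u) (hvu : v < u * G) (hΛQ : u * Q₂ < Λ * (u * G - v))
    {n : ℤ} (hn : (Λ : ℤ) ≤ |n|) :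
    Real.pi / (((n.natAbs * G : ℕ) : ℝ) - ((v * n.natAbs / u + Q₂ : ℕ) : ℝ)) ≤
      (u : ℝ) * Real.pi / (((u : ℝ) * G - v) * Λ - u * Q₂) := by
  have hur : (0 : ℝ) < u := by exact_mod_cast hu
  have hc2 : (0 : ℝ) < (u : ℝ) * G - v := by
    have : (v : ℝ) < (u : ℝ) * G := by exact_mod_cast hvu
    linarith
  have hΛr : (u : ℝ) * Q₂ < ((u : ℝ) * G - v) * Λ := by
    have h1 : ((u * Q₂ : ℕ) : ℝ) < ((Λ * (u * G - v) : ℕ) : ℝ) := by exact_mod_cast hΛQ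
    rw [Nat.cast_mul, Nat.cast_mul, Nat.cast_sub hvu.le, Nat.cast_mul] at h1
    linarith
  have hx : (Λ : ℝ) ≤ (n.natAbs : ℝ) := by
    have h1 : Λ ≤ n.natAbs := by rw [← Int.natCast_natAbs] at hn; exact_mod_cast hn
    exact_mod_cast h1
  have hup : (u : ℝ) * ((v * n.natAbs / u + Q₂ : ℕ) : ℝ) ≤ (v : ℝ) * (n.natAbs : ℝ) + u * Q₂ := by
    have h : u * (v * n.natAbs / u + Q₂) ≤ v * n.natAbs + u * Q₂ := by
      have hdiv : u * (v * n.natAbs / u) ≤ v * n.natAbs := Nat.mul_div_le _ _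
      rw [Nat.mul_add]; exact Nat.add_le_add_right hdiv _
    exact_mod_cast h
  have hnG : ((n.natAbs * G : ℕ) : ℝ) = (n.natAbs : ℝ) * G := by push_cast; rfl
  rw [hnG]
  set p : ℝ := ((v * n.natAbs / u + Q₂ : ℕ) : ℝ) with hp
  have hD : 0 < ((u : ℝ) * G - v) * Λ - u * Q₂ := by linarith
  have hm : ((u : ℝ) * G - v) * Λ ≤ ((u : ℝ) * G - v) * (n.natAbs : ℝ) := mul_le_mul_of_nonneg_left hx hc2.le
  have e1 : ((u : ℝ) * G - v) * (n.natAbs : ℝ) = u * ((n.natAbs : ℝ) * G) - v * (n.natAbs : ℝ) := by ring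
  have e2 : ((n.natAbs : ℝ) * G - p) * u = u * ((n.natAbs : ℝ) * G) - u * p := by ring
  have h1 : (((u : ℝ) * G - v) * Λ - u * Q₂) / u ≤ (n.natAbs : ℝ) * G - p := by
    rw [div_le_iff₀ hur, e2]
    linarith
  calc Real.pi / ((n.natAbs : ℝ) * G - p) ≤ Real.pi / ((((u : ℝ) * G - v) * Λ - u * Q₂) / u) :=
        div_le_div_of_nonneg_left Real.pi_pos.le (div_pos hD hur) h1
    _ = (u : ℝ) * Real.pi / (((u : ℝ) * G - v) * Λ - u * Q₂) := by
        rw [div_div_eq_mul_div, mul_comm]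


/-! ## §2 The strip / low-fibre window (constant plateau `K + Q₂`) -/

/-- **The strip plateau stays below the chirp shift** (S1): `K + Q₂ < ΛG` and `|n| ≥ Λ` give `K + Q₂ < |n|G`. [folklore] -/
theorem stripPlateau_lt_shift {K G Q₂ Λ : ℕ} (hΛ : K + Q₂ < Λ * G) {n : ℤ} (hn : (Λ : ℤ) ≤ |n|) :
    K + Q₂ < n.natAbs * G := by
  have h1 : Λ ≤ n.natAbs := by rw [← Int.natCast_natAbs] at hn; exact_mod_cast hn
  exact lt_of_lt_of_le hΛ (Nat.mul_le_mul_right _ h1)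

/-- **The trapezoid RATIO constant of a fibre block, strip window** (S3): with the constant plateau `p = K + Q₂ < ΛG`, every
fibre `|n| ≥ Λ` has `(p + |n|G)/(|n|G − p) ≤ (p + ΛG)/(ΛG − p)`. [folklore] -/
theorem stripKernel_ratio_le {K G Q₂ Λ : ℕ} (hΛ : K + Q₂ < Λ * G) {n : ℤ} (hn : (Λ : ℤ) ≤ |n|) :
    (((K + Q₂ : ℕ) : ℝ) + ((n.natAbs * G : ℕ) : ℝ)) / (((n.natAbs * G : ℕ) : ℝ) - ((K + Q₂ : ℕ) : ℝ)) ≤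
      (((K + Q₂ : ℕ) : ℝ) + ((Λ * G : ℕ) : ℝ)) / (((Λ * G : ℕ) : ℝ) - ((K + Q₂ : ℕ) : ℝ)) := by
  have hx : (Λ : ℝ) ≤ (n.natAbs : ℝ) := by
    have h1 : Λ ≤ n.natAbs := by rw [← Int.natCast_natAbs] at hn; exact_mod_cast hn
    exact_mod_cast h1
  have hQ : (((K + Q₂ : ℕ) : ℝ)) < (G : ℝ) * Λ := by
    have h1 : ((K + Q₂ : ℕ) : ℝ) < ((Λ * G : ℕ) : ℝ) := by exact_mod_cast hΛ
    rw [Nat.cast_mul] at h1; linarith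
  have hG : (0 : ℝ) < G := by
    rcases Nat.eq_zero_or_pos G with h | h
    · subst h; simp at hΛ
    · exact_mod_cast h
  have e1 : ((n.natAbs * G : ℕ) : ℝ) = (G : ℝ) * n.natAbs := by push_cast; ring
  have e2 : ((Λ * G : ℕ) : ℝ) = (G : ℝ) * Λ := by push_cast; ring
  rw [e1, e2, add_comm (((K + Q₂ : ℕ) : ℝ)) ((G : ℝ) * n.natAbs), add_comm (((K + Q₂ : ℕ) : ℝ)) ((G : ℝ) * Λ)]
  exact ratioClass_ratio_le hx hQ (by positivity) hG.le hG

/-- **The kernel LAYER constant of a fibre block, strip window** (S4): `π/(|n|G − (K+Q₂)) ≤ π/(ΛG − (K+Q₂))` for `|n| ≥ Λ`,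
`K + Q₂ < ΛG`. [folklore] -/
theorem stripKernel_tau_le {K G Q₂ Λ : ℕ} (hΛ : K + Q₂ < Λ * G) {n : ℤ} (hn : (Λ : ℤ) ≤ |n|) :
    Real.pi / (((n.natAbs * G : ℕ) : ℝ) - ((K + Q₂ : ℕ) : ℝ)) ≤ Real.pi / (((Λ * G : ℕ) : ℝ) - ((K + Q₂ : ℕ) : ℝ)) := by
  have h1 : ((K + Q₂ : ℕ) : ℝ) < ((Λ * G : ℕ) : ℝ) := by exact_mod_cast hΛ
  have h2 : ((Λ * G : ℕ) : ℝ) ≤ ((n.natAbs * G : ℕ) : ℝ) := by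
    have h : Λ ≤ n.natAbs := by rw [← Int.natCast_natAbs] at hn; exact_mod_cast hn
    exact_mod_cast Nat.mul_le_mul_right G h
  exact div_le_div_of_nonneg_left Real.pi_pos.le (by linarith) (by linarith)

end Summit.AnomalousDissipation.AnomalousDissipation.Theorems.SawtoothPulseCascade.K1Window
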